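import Mathlib.Combinatorics.SimpleGraph.Metric
import Mathlib.Combinatorics.SimpleGraph.Acyclic
import Mathlib.Algebra.Group.Subgroup.Lattice
import Literature.AnabelianGeometry.SemiGraphs.TreeGeodesics
import Literature.AnabelianGeometry.SemiGraphs.FreeGroupsAndActionsProofs2
import Literature.AnabelianGeometry.SemiGraphs.SemiGraphIsoTransport
import HarnessLib

/-!
# A group acting on a semi-graph over a tree is generated by its vertex stabilisers ([SemiAnbd] Thm 3.7 (iii), Prop 3.6)

Mochizuki, *Semi-graphs of anabelioids*, Publ. RIMS **42** (2006), §3: Proposition 3.6 p. 38 (the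
tempered fundamental group is built from the universal graph-coverings `𝒢_{∞,i} → 𝒢_i` of the finite
étale Galois coverings of `𝒢`) and the proof of Theorem 3.7 (iii) p. 41 [cite: MochizukiSemiAnbd2006,
Thm 3.7(iii) p.41]; used again in §5, proof of Theorem 5.4 p. 66.  The input isolated by the cell's
decomposition of [SemiAnbd] Thm 5.4 (plan/GAP-LEDGER.md G-w4d053-1, residual (E1c), abc-iut-L3-d4's
`TemperedPiVertexGenerated.lean`, binder `hgen` of `GaloisLevelData.hK_of_vertGen`) is the identity
"`Ker(π₁^temp(𝒢_n) ↠ π₁(𝔾_n))` is topologically generated by the verticial subgroups", which at each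
deeper level `m` is the following classical statement of Bass–Serre theory (cf. Serre, *Trees*
[SerreTrees1980], Ch. I §§4–5: a group acting on a tree with a subtree as fundamental domain is the
amalgam of its stabilisers along that subtree): **a group `K` acting on a tree `X̃` in such a way that
the quotient `K \ X̃` is again a tree is generated by its vertex stabilisers** — applied
to `K := Gal(𝒢_{∞,m}/𝒢_{∞,n})` acting on the tree `𝔾̃_m` with quotient the tree `𝔾̃_n`.

This PROOF-ONLY file (no definitions, pure combinatorial group theory) supplies that statement in the
COVERING form the consumer meets — the quotient is presented by a morphism `φ : X ⟶ Y` to a tree `Y`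
which is `K`-invariant and along whose vertex stars `K` acts transitively on the fibres (the shape of
a Galois graph-covering with group `K`; no freeness of the action is needed, and `X` need only be
connected):

* `SemiGraph.le_closure_vertexStabilizers_of_hom_to_tree`: for `ρ : Γ →* Aut X`, `K ≤ Γ`,
  `φ : X ⟶ Y` with `Y` a tree, `(ρ k).hom ≫ φ = φ` for `k ∈ K`, and for every vertex `v` and branches
  `b, b'` abutting to `v` with `φ(b) = φ(b')` some `k ∈ K` fixing `v` with `k b = b'`, the subgroup
  `K` is contained in the subgroup generated by `{k ∈ K | k fixes some vertex of X}` (given one vertex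
  of `X`); `…_of_branch_orbits` is the variant with the hypothesis "the fibres of `φ` on abutting
  branches are `K`-orbits".
* The combinatorial core, for arbitrary simple graphs (`mem_of_walk_of_starTransitive`,
  `mem_closure_stabilizers_of_walk`): if `K` acts on a graph `S` over a graph homomorphism
  `f : S →g T` to a FOREST `T` (`f ∘ k = f`, and `K_a` transitive on the fibres of `f` on the
  neighbours of every node `a`), then every `g ∈ K` such that `x` and `g • x` are joined by a walk lies
  in the subgroup generated by the stabilisers.  Proof: induction on the length of the walk — its image
  is a CLOSED walk in the forest `T`, a node of maximal distance from the base point is a peak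
  (`exists_backtrack_of_closed_walk`, from Mathlib's `IsAcyclic.dist_eq_dist_add_one_of_adj_of_reachable`
  and the no-peak lemma `eq_of_dist_eq_succ_of_adj` of `TreeGeodesics.lean`), so its two neighbours on
  the walk have the same image, star-transitivity provides a stabiliser element folding the walk to a
  walk of length two less.

Nothing here is specific to [SemiAnbd]; nothing here bears on [IUTchIII] Cor. 3.12.
-/

namespace Literature.AnabelianGeometry.SemiGraphs

open SimpleGraph

universe u v

/-! ### The combinatorial core: closed walks in a forest backtrack -/

section SimpleGraphLevel

variable {V W : Type*} {S : SimpleGraph V} {T : SimpleGraph W}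

/-- **A closed walk of length `≥ 2` in a forest has a peak**: an interior node both of whose
neighbours on the walk coincide (a node of the walk at maximal distance from its base point; in an
acyclic graph adjacent nodes have distances differing by exactly one, and a node has at most one
neighbour strictly closer to the base point). [cite: MochizukiSemiAnbd2006, Thm 3.7(iii) p.41] -/
theorem exists_backtrack_of_closed_walk (hT : T.IsAcyclic) {o : W} (q : T.Walk o o)
    (hq : 2 ≤ q.length) :
    ∃ j : ℕ, 0 < j ∧ j < q.length ∧ q.getVert (j - 1) = q.getVert (j + 1) := by
  classical
  have hreach : ∀ i, T.Reachable o (q.getVert i) := fun i => (q.take i).reachable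
  obtain ⟨j, hjmem, hjmax⟩ := (Finset.range (q.length + 1)).exists_max_image
    (fun i => T.dist o (q.getVert i)) ⟨0, by simp⟩
  have hmax : ∀ i, i ≤ q.length → T.dist o (q.getVert i) ≤ T.dist o (q.getVert j) :=
    fun i hi => hjmax i (Finset.mem_range.mpr (Nat.lt_succ_of_le hi))
  have hjle : j ≤ q.length := Nat.le_of_lt_succ (Finset.mem_range.mp hjmem)
  -- the first step of the walk leaves `o`, so the maximal distance is positive
  have h01 : T.Adj o (q.getVert 1) := by
    have h := q.adj_getVert_succ (i := 0) (by omega)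
    rwa [q.getVert_zero] at h
  have hd1 : T.dist o (q.getVert 1) = 1 := dist_eq_one_iff_adj.mpr h01
  have hdj : 1 ≤ T.dist o (q.getVert j) := hd1 ▸ hmax 1 (by omega)
  have hj0 : 0 < j := by
    rcases Nat.eq_zero_or_pos j with rfl | h
    · rw [q.getVert_zero, SimpleGraph.dist_self] at hdj
      exact absurd hdj (by norm_num)
    · exact h
  have hjl : j < q.length := by
    rcases hjle.lt_or_eq with h | h
    · exact h
    · rw [h, q.getVert_length, SimpleGraph.dist_self] at hdj
      exact absurd hdj (by norm_num)
  refine ⟨j, hj0, hjl, ?_⟩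
  -- the two neighbours of the peak are strictly closer to `o`, hence equal
  have h1 : T.Adj (q.getVert (j - 1)) (q.getVert j) := by
    have h := q.adj_getVert_succ (i := j - 1) (by omega)
    rwa [Nat.sub_add_cancel hj0] at h
  have h2 : T.Adj (q.getVert j) (q.getVert (j + 1)) := q.adj_getVert_succ hjl
  have e1 : T.dist o (q.getVert j) = T.dist o (q.getVert (j - 1)) + 1 := by
    rcases hT.dist_eq_dist_add_one_of_adj_of_reachable o h1 (hreach _) with h | h
    · have := hmax (j - 1) (by omega)
      omega
    · exact h
  have e2 : T.dist o (q.getVert j) = T.dist o (q.getVert (j + 1)) + 1 := by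
    rcases hT.dist_eq_dist_add_one_of_adj_of_reachable o h2 (hreach _) with h | h
    · exact h
    · have := hmax (j + 1) (by omega)
      omega
  exact eq_of_dist_eq_succ_of_adj hT h1 h2.symm (hreach _) (hreach _) e1 e2

/-- **Generation by stabilisers, combinatorial core.**  A group `Γ` acts on the nodes of a graph `S`
by graph maps (`act`), `f : S →g T` is a graph homomorphism to a FOREST `T` which is invariant under
the subgroup `K`, and `H ≤ K` is a subgroup such that for every node `a` and neighbours `b`, `b'` of
`a` with `f b = f b'` some `h ∈ H` fixes `a` and carries `b` to `b'` ("`H_a` is transitive on the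
fibres of `f` along the star of `a`").  If the `K`-stabiliser of the node `x` lies in `H`, then every
`g ∈ K` for which `x` and `g • x` are joined by a walk of `S` lies in `H`.  (Induction on the length
of the walk: its image is a closed walk in `T`, which backtracks at a peak by
`exists_backtrack_of_closed_walk`; star-transitivity at the peak folds the walk to a walk from `x` to
`(h⁻¹ g) • x` two steps shorter.) [cite: MochizukiSemiAnbd2006, Thm 3.7(iii) p.41] -/
theorem mem_of_walk_of_starTransitive (hT : T.IsAcyclic) {Γ : Type*} [Group Γ]
    (act : Γ → V → V) (act_one : ∀ x, act 1 x = x)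
    (act_mul : ∀ γ δ x, act (γ * δ) x = act γ (act δ x))
    (act_adj : ∀ (γ : Γ) {a b : V}, S.Adj a b → S.Adj (act γ a) (act γ b))
    (f : S →g T) (K H : Subgroup Γ) (hHK : H ≤ K)
    (hfK : ∀ k ∈ K, ∀ a, f (act k a) = f a)
    (hstar : ∀ (a b b' : V), S.Adj a b → S.Adj a b' → f b = f b' →
      ∃ h ∈ H, act h a = a ∧ act h b = b')
    {x : V} (hx : ∀ k ∈ K, act k x = x → k ∈ H) {g : Γ} (hg : g ∈ K)
    (p : S.Walk x (act g x)) : g ∈ H := by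
  -- induction on an upper bound `n` of the length of the walk
  suffices key : ∀ (n : ℕ) (g : Γ), g ∈ K → ∀ p : S.Walk x (act g x), p.length ≤ n → g ∈ H from
    key _ g hg p le_rfl
  intro n
  induction n with
  | zero =>
    intro g hg p hp
    have h0 : x = act g x := Walk.eq_of_length_eq_zero (p := p) (Nat.le_zero.mp hp)
    exact hx g hg h0.symm
  | succ n ih =>
    intro g hg p hp
    rcases Nat.lt_or_ge p.length (n + 1) with hlt | hge
    · exact ih g hg p (Nat.lt_succ_iff.mp hlt)
    have hlen : p.length = n + 1 := le_antisymm hp hge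
    rcases Nat.lt_or_ge (n + 1) 2 with hn | hn
    · -- a walk of length one would map to a loop of the forest `T`
      have hadj : T.Adj (f x) (f (act g x)) := f.map_adj (Walk.adj_of_length_eq_one (p := p) (by omega))
      rw [hfK g hg x] at hadj
      exact absurd hadj (SimpleGraph.irrefl _)
    · -- the image of `p` is a closed walk of length `≥ 2` in `T`: it has a peak at `p.getVert j`
      let q : T.Walk (f x) (f x) := (p.map f).copy rfl (hfK g hg x)
      have hq : q.length = n + 1 := by
        simp only [q, Walk.length_copy, Walk.length_map, hlen]
      have hqv : ∀ i, q.getVert i = f (p.getVert i) := fun i => by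
        simp only [q, Walk.getVert_copy, Walk.getVert_map]
      obtain ⟨j, hj0, hjl, hback⟩ := exists_backtrack_of_closed_walk hT q (by omega)
      rw [hqv, hqv] at hback
      rw [hq] at hjl
      have hab : S.Adj (p.getVert j) (p.getVert (j - 1)) := by
        have h := p.adj_getVert_succ (i := j - 1) (by omega)
        rw [Nat.sub_add_cancel hj0] at h
        exact h.symm
      have hab' : S.Adj (p.getVert j) (p.getVert (j + 1)) := p.adj_getVert_succ (by omega)
      obtain ⟨h, hhH, -, hhb⟩ := hstar _ _ _ hab hab' hback
      -- fold: `x ⟶ p.getVert (j-1) = h⁻¹ • p.getVert (j+1) ⟶ h⁻¹ • (g • x) = (h⁻¹ g) • x`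
      let φh : S →g S := ⟨act h⁻¹, fun hab => act_adj h⁻¹ hab⟩
      have e1 : φh (p.getVert (j + 1)) = p.getVert (j - 1) := by
        show act h⁻¹ (p.getVert (j + 1)) = p.getVert (j - 1)
        rw [← hhb, ← act_mul, inv_mul_cancel, act_one]
      have e2 : φh (act g x) = act (h⁻¹ * g) x := by
        show act h⁻¹ (act g x) = act (h⁻¹ * g) x
        rw [act_mul]
      let p' : S.Walk x (act (h⁻¹ * g) x) :=
        (p.take (j - 1)).append (((p.drop (j + 1)).map φh).copy e1 e2)
      have hp' : p'.length ≤ n := by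
        simp only [p', Walk.length_append, Walk.length_copy, Walk.length_map, Walk.take_length,
          Walk.drop_length, hlen]
        rw [Nat.min_eq_left (by omega)]
        omega
      have hg' : h⁻¹ * g ∈ K := K.mul_mem (K.inv_mem (hHK hhH)) hg
      have hmem : h⁻¹ * g ∈ H := ih (h⁻¹ * g) hg' p' hp'
      have hgeq : g = h * (h⁻¹ * g) := by group
      rw [hgeq]
      exact H.mul_mem hhH hmem

/-- **Generation by stabilisers, closure form**: under the same hypotheses with the star condition
witnessed inside `K` itself, every `g ∈ K` with `x` and `g • x` in one component of `S` lies in the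
subgroup generated by the elements of `K` fixing some node. [cite: MochizukiSemiAnbd2006, Thm 3.7(iii) p.41] -/
theorem mem_closure_stabilizers_of_walk (hT : T.IsAcyclic) {Γ : Type*} [Group Γ]
    (act : Γ → V → V) (act_one : ∀ x, act 1 x = x)
    (act_mul : ∀ γ δ x, act (γ * δ) x = act γ (act δ x))
    (act_adj : ∀ (γ : Γ) {a b : V}, S.Adj a b → S.Adj (act γ a) (act γ b))
    (f : S →g T) (K : Subgroup Γ) (hfK : ∀ k ∈ K, ∀ a, f (act k a) = f a)
    (hstar : ∀ (a b b' : V), S.Adj a b → S.Adj a b' → f b = f b' →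
      ∃ k ∈ K, act k a = a ∧ act k b = b')
    {x : V} {g : Γ} (hg : g ∈ K) (p : S.Walk x (act g x)) :
    g ∈ Subgroup.closure {k | k ∈ K ∧ ∃ a, act k a = a} := by
  refine mem_of_walk_of_starTransitive hT act act_one act_mul act_adj f K
    (Subgroup.closure {k | k ∈ K ∧ ∃ a, act k a = a}) ?_ hfK ?_ ?_ hg p
  · exact (Subgroup.closure_le K).mpr fun k hk => hk.1
  · intro a b b' hab hab' hfb
    obtain ⟨k, hk, hka, hkb⟩ := hstar a b b' hab hab' hfb
    exact ⟨k, Subgroup.subset_closure ⟨hk, a, hka⟩, hka, hkb⟩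
  · intro k hk hkx
    exact Subgroup.subset_closure ⟨hk, x, hkx⟩

end SimpleGraphLevel

/-! ### Semi-graphs: a group acting over a morphism to a tree -/

namespace SemiGraph

open CategoryTheory

variable {X Y : SemiGraph.{u}}

/-- **A group acting on a connected semi-graph over a `K`-invariant morphism to a tree, transitively
on the fibres of the vertex stars, is generated by its vertex stabilisers** (Bass–Serre: a group
acting on a tree with a tree as quotient is generated by its vertex stabilisers; covering form used in
the construction of `π₁^temp` from the universal graph-coverings `𝒢_{∞,i} → 𝒢_i`, [SemiAnbd] Prop 3.6
p. 38, proof of Thm 3.7 (iii) p. 41, proof of Thm 5.4 p. 66).  Precisely: `ρ : Γ →* Aut X` with `X`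
connected, `φ : X ⟶ Y` with `Y` a tree, `K ≤ Γ` with `(ρ k).hom ≫ φ = φ` for `k ∈ K`, and for each
vertex `v` and branches `b`, `b'` abutting to `v` with `φ(b) = φ(b')` an element of `K` fixing `v` and
carrying `b` to `b'`; then, `X` having a vertex, `K` lies in the subgroup generated by
`{k ∈ K | k fixes a vertex of X}`.  At edge- and branch-points of the barycentric subdivision the
star condition of `mem_of_walk_of_starTransitive` is automatic (a morphism is injective on the branches
of an edge; the two neighbours of a branch-point have different types).
[cite: MochizukiSemiAnbd2006, Thm 3.7(iii) p.41] -/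
theorem le_closure_vertexStabilizers_of_hom_to_tree (hX : X.IsConnected) (hY : Y.IsTree)
    {Γ : Type v} [Group Γ] (ρ : Γ →* Aut X) (K : Subgroup Γ) (φ : X ⟶ Y)
    (hφ : ∀ k ∈ K, (ρ k).hom ≫ φ = φ)
    (hstar : ∀ (v : X.Vertex) (b b' : X.Branch), X.abuts b = some v → X.abuts b' = some v →
      φ.branchMap b = φ.branchMap b' →
        ∃ k ∈ K, (ρ k).hom.vertexMap v = v ∧ (ρ k).hom.branchMap b = b')
    (v₀ : X.Vertex) :
    K ≤ Subgroup.closure {k | k ∈ K ∧ ∃ v : X.Vertex, (ρ k).hom.vertexMap v = v} := by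
  intro g hg
  -- the graph homomorphism of barycentric subdivisions induced by `φ`, and the action on nodes
  let f : X.subdivision →g Y.subdivision := ⟨Hom.nodeMap φ, fun h => subdivision_adj_map φ h⟩
  have act_one : ∀ x : X.Node, nodeMap (ρ 1) x = x := by
    intro x
    rw [map_one]
    rcases x with v | e | b <;> rfl
  have act_mul : ∀ (γ δ : Γ) (x : X.Node),
      nodeMap (ρ (γ * δ)) x = nodeMap (ρ γ) (nodeMap (ρ δ) x) := by
    intro γ δ x
    rw [map_mul]
    rcases x with v | e | b <;> rfl
  have hfK : ∀ k ∈ K, ∀ x : X.Node, f (nodeMap (ρ k) x) = f x := by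
    intro k hk x
    show Hom.nodeMap φ (Hom.nodeMap (ρ k).hom x) = Hom.nodeMap φ x
    rw [← Hom.nodeMap_comp, hφ k hk]
  set H : Subgroup Γ := Subgroup.closure {k | k ∈ K ∧ ∃ v : X.Vertex, (ρ k).hom.vertexMap v = v}
    with hH
  have hHK : H ≤ K := (Subgroup.closure_le K).mpr fun k hk => hk.1
  have hx : ∀ k ∈ K, nodeMap (ρ k) (Sum.inl v₀) = (Sum.inl v₀ : X.Node) → k ∈ H := by
    intro k hk h
    refine Subgroup.subset_closure ⟨hk, v₀, ?_⟩
    simpa using h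
  -- star transitivity at every node of the subdivision
  have hstar' : ∀ (a b b' : X.Node), X.subdivision.Adj a b → X.subdivision.Adj a b' → f b = f b' →
      ∃ h ∈ H, nodeMap (ρ h) a = a ∧ nodeMap (ρ h) b = b' := by
    intro a b b' hab hab' hfb
    rcases a with v | e | c
    · -- a vertex-point: its neighbours are the points of the branches abutting to it
      obtain ⟨b₁, hb₁, rfl⟩ := (X.subdivision_adj_inl_iff v b).mp hab
      obtain ⟨b₂, hb₂, rfl⟩ := (X.subdivision_adj_inl_iff v b').mp hab'
      have hφb : φ.branchMap b₁ = φ.branchMap b₂ := by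
        simpa [f, Hom.nodeMap] using hfb
      obtain ⟨k, hk, hkv, hkb⟩ := hstar v b₁ b₂ hb₁ hb₂ hφb
      exact ⟨k, Subgroup.subset_closure ⟨hk, v, hkv⟩, by simp [hkv], by simp [hkb]⟩
    · -- an edge-point: its neighbours are the points of its two branches, on which `φ` is injective
      obtain ⟨b₁, hb₁, rfl⟩ := (X.subdivision_adj_edge_iff e b).mp hab
      obtain ⟨b₂, hb₂, rfl⟩ := (X.subdivision_adj_edge_iff e b').mp hab'
      have hφb : φ.branchMap b₁ = φ.branchMap b₂ := by
        simpa [f, Hom.nodeMap] using hfb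
      obtain rfl : b₁ = b₂ := φ.branchMap_injOn b₁ b₂ (hb₁.trans hb₂.symm) hφb
      exact ⟨1, H.one_mem, act_one _, act_one _⟩
    · -- a branch-point: its neighbours are its edge-point and the vertex it abuts to
      rcases (X.subdivision_adj_branch_iff c b).mp hab with rfl | ⟨w, hw, rfl⟩ <;>
        rcases (X.subdivision_adj_branch_iff c b').mp hab' with rfl | ⟨w', hw', rfl⟩
      · exact ⟨1, H.one_mem, act_one _, act_one _⟩
      · exact absurd hfb (by simp [f, Hom.nodeMap])
      · exact absurd hfb (by simp [f, Hom.nodeMap])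
      · obtain rfl : w = w' := Option.some_injective _ (hw.symm.trans hw')
        exact ⟨1, H.one_mem, act_one _, act_one _⟩
  -- a walk from the base vertex to its `g`-translate
  obtain ⟨p⟩ := hX.connected.preconnected (Sum.inl v₀) (nodeMap (ρ g) (Sum.inl v₀))
  exact mem_of_walk_of_starTransitive hY.isTree.isAcyclic (fun γ => nodeMap (ρ γ)) act_one act_mul
    (fun γ _ _ h => subdivision_adj_nodeMap (ρ γ) h) f K H hHK hfK hstar' hx hg p

/-- Variant of `le_closure_vertexStabilizers_of_hom_to_tree` with the hypothesis in orbit form: the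
fibres of `φ` on abutting branches are `K`-orbits ("`X ⟶ Y` is Galois with group `K`" on branches);
the vertex condition then follows from the compatibility of automorphisms with the coincidence maps.
[cite: MochizukiSemiAnbd2006, Thm 3.7(iii) p.41] -/
theorem le_closure_vertexStabilizers_of_branch_orbits (hX : X.IsConnected) (hY : Y.IsTree)
    {Γ : Type v} [Group Γ] (ρ : Γ →* Aut X) (K : Subgroup Γ) (φ : X ⟶ Y)
    (hφ : ∀ k ∈ K, (ρ k).hom ≫ φ = φ)
    (hbr : ∀ (b b' : X.Branch), (X.abuts b).isSome → φ.branchMap b = φ.branchMap b' →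
      ∃ k ∈ K, (ρ k).hom.branchMap b = b')
    (v₀ : X.Vertex) :
    K ≤ Subgroup.closure {k | k ∈ K ∧ ∃ v : X.Vertex, (ρ k).hom.vertexMap v = v} := by
  refine le_closure_vertexStabilizers_of_hom_to_tree hX hY ρ K φ hφ ?_ v₀
  intro v b b' hb hb' hφb
  obtain ⟨k, hk, hkb⟩ := hbr b b' (by rw [hb]; rfl) hφb
  refine ⟨k, hk, ?_, hkb⟩
  have h := (ρ k).hom.abuts_branchMap b v hb
  rw [hkb, hb'] at h
  exact (Option.some_injective _ h).symm

end SemiGraph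

end Literature.AnabelianGeometry.SemiGraphs
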